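import Summits.ResolutionOfSingularities.ResolutionOfSingularities.Theorems.WeightedInvariantHypersurfaceLocalGameEFTPointMoveChart
import HarnessLib

/-!
# The exceptional chart of the cobordant blow-up of a PARTIAL regular system of parameters (curve / cylinder centres)

Topic: `Summits/ResolutionOfSingularities/ResolutionOfSingularities/Theorems`. Helper for the door item
`HypersurfaceCentreConstruction` (statement `stmt-ResolutionOfSingularities-19897`, route `WeightedInvariant`), line
`local-engine`, P3 rung: shared brick of ORDER (o36) «(P3a-drop) over the special point» (res-type-092) and ORDER (o33-a)
«ν does not rise» (res-type-098), IOTA3-DESIGN v1.2 of `res-L1-w43-plan-1`.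

[OURS · L1 W4.3] K3a's exceptional chart (`LocalGameEFTPointMove.rho`, res-type-098 p507345) presents `B/(t⁻¹)` for a move on a
FULL regular system of parameters.  A curve/cylinder centre uses only a SUB-family `u = (u₁,…,uₘ)` of a regular system of
parameters of the regular local ring `S` (the centre `V(u)` is a regular prime of positive dimension) with positive weights on
these; then `B = S[t⁻¹, 𝒥ₙ(u; w) tⁿ]` has exceptional fibre ring `B/(t⁻¹) ≅ (S/(u))[X₁,…,Xₘ]`, a polynomial ring over the
REGULAR LOCAL RING `S/(u)` (Włodarczyk §2.3.9: the exceptional divisor of the full cobordant blow-up is the weighted normal bundle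
`Spec (𝒪/(u))[u′]`).  Everything is the tree's `extRees_exists_quotient_equiv` (res-type-048/078 pattern) fed with the weighted
quasi-regularity of a sub-family with independent cotangent classes (`weightedQuasiRegular_of_linearIndependent_toCotangent`).
Def-free (the chart map is delivered by `∃`).  NOT a statement of the manuscript under review (Hironaka 2017); nothing here is a
claim about resolution of singularities.  AI work, weaker than expert review.

## References

* J. Włodarczyk, *Functorial resolution by torus actions*, arXiv:2203.03090, Def. 2.3.5, §2.3.9. [Wlodarczyk2022]
* H. Matsumura, *Commutative Ring Theory*, Thm. 14.2, Thm. 16.2. [Matsumura1987]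
-/

noncomputable section

open IsLocalRing Literature.AlgebraicGeometry.Resolution
open LaurentPolynomial
open scoped LaurentPolynomial
open Summit.ResolutionOfSingularities.ResolutionOfSingularities.Cruxes.HypersurfaceCentreConstruction.LocalEngine
  (iotaOrd iotaOrd_le_of_ringHom)

set_option linter.dupNamespace false -- mandated namespace of this single-conjunct summit

namespace Summit.ResolutionOfSingularities.ResolutionOfSingularities.Theorems

namespace LocalGameEFTPointMove

variable {S : Type} [CommRing S] [IsRegularLocalRing S] {d : ℕ} (u : Fin d → S) (w : Fin d → ℕ)

/-- A sub-family of a regular system of parameters (cotangent-independent elements of `𝔪`) with positive weights is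
weighted quasi-regular. [cite: Matsumura1987, Thm. 16.2] -/
theorem hwqr_of_linearIndependent (hw : ∀ i, 0 < w i) (hmem : ∀ i, u i ∈ maximalIdeal S)
    (hli : LinearIndependent (ResidueField S) fun i => (maximalIdeal S).toCotangent ⟨u i, hmem i⟩)
    (n : ℕ) (P : MvPolynomial (Fin d) S) (hP : P.IsWeightedHomogeneous w n)
    (heval : MvPolynomial.eval u P ∈ (weightedFiltration u w).ideal (n + 1)) (β : Fin d →₀ ℕ) :
    P.coeff β ∈ Ideal.span (Set.range u) :=
  weightedQuasiRegular_of_linearIndependent_toCotangent u w hw hmem hli n P hP heval β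

/-- **The exceptional chart of a partial regular system of parameters.**  `S` regular local, `u : Fin d → S` elements of `𝔪`
with independent cotangent classes (part of a regular system of parameters), weights all positive.  Then there is a SURJECTIVE
ring map `ρ : B = S[t⁻¹, 𝒥ₙ(u;w) tⁿ] → (S/(u))[X₁,…,X_d]` with kernel `(t⁻¹)`, `ρ(uᵢ t^{wᵢ}) = Xᵢ`, `ρ(a) = ā`, `ρ(t⁻¹) = 0`.
[cite: Wlodarczyk2022, §2.3.9] -/
theorem exists_rhoPartial (hw : ∀ i, 0 < w i) (hmem : ∀ i, u i ∈ maximalIdeal S)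
    (hli : LinearIndependent (ResidueField S) fun i => (maximalIdeal S).toCotangent ⟨u i, hmem i⟩) :
    ∃ ρ : extReesAlgebra (weightedMonomialIdeal u w) →+* MvPolynomial (Fin d) (S ⧸ Ideal.span (Set.range u)),
      Function.Surjective ρ ∧
      RingHom.ker ρ = Ideal.span {extReesAlgebra.tInv (weightedMonomialIdeal u w)} ∧
      (∀ i, ρ (uT u w i) = MvPolynomial.X i) ∧
      (∀ a : S, ρ (algebraMap S _ a) = MvPolynomial.C (Ideal.Quotient.mk _ a)) ∧
      ρ (extReesAlgebra.tInv (weightedMonomialIdeal u w)) = 0 := by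
  obtain ⟨e, heX, heC⟩ := extRees_exists_quotient_equiv (stub_extReesAlgebra_weighted u w) (uT u w) (fun _ => rfl) hw
    (hwqr_of_linearIndependent u w hw hmem hli)
  refine ⟨e.toRingHom.comp (Ideal.Quotient.mk _), ?_, ?_, fun i => ?_, fun a => ?_, ?_⟩
  · exact e.surjective.comp Ideal.Quotient.mk_surjective
  · ext b
    rw [RingHom.mem_ker, RingHom.comp_apply, RingEquiv.toRingHom_eq_coe, RingHom.coe_coe,
      EmbeddingLike.map_eq_zero_iff, Ideal.Quotient.eq_zero_iff_mem]
  · exact heX i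
  · exact heC a
  · rw [RingHom.comp_apply, Ideal.Quotient.eq_zero_iff_mem.mpr (Ideal.mem_span_singleton_self _), map_zero]

/-- **Rank bound through the partial chart.**  For any such `ρ` and a prime `𝔫 ∋ t⁻¹` of `B`: `𝔫̄ := ρ(𝔫)` is prime, `ρ⁻¹(𝔫̄) = 𝔫`,
and `ord_{B_𝔫}(b) ≤ ord_{(S/(u))[X]_{𝔫̄}}(ρ b)` for every `b ∈ B` (`iotaOrd` form: `iotaOrd_localization_le_of_comap_eq`).
[folklore] -/
theorem comap_map_eq_of_ker_eq {B P : Type} [CommRing B] [CommRing P] (ρ : B →+* P) (hρ : Function.Surjective ρ)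
    {t : B} (hker : RingHom.ker ρ = Ideal.span {t}) (𝔫 : Ideal B) (ht : t ∈ 𝔫) :
    (𝔫.map ρ).comap ρ = 𝔫 := by
  rw [Ideal.comap_map_of_surjective' _ hρ, hker]
  exact sup_eq_left.mpr ((Ideal.span_singleton_le_iff_mem _).mpr ht)

/-- The image of a prime containing the kernel generator is prime. [folklore] -/
theorem map_isPrime_of_ker_eq {B P : Type} [CommRing B] [CommRing P] (ρ : B →+* P) (hρ : Function.Surjective ρ)
    {t : B} (hker : RingHom.ker ρ = Ideal.span {t}) (𝔫 : Ideal B) [𝔫.IsPrime] (ht : t ∈ 𝔫) :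
    (𝔫.map ρ).IsPrime :=
  Ideal.map_isPrime_of_surjective hρ (by rw [hker, Ideal.span_singleton_le_iff_mem]; exact ht)

omit [IsRegularLocalRing S] in
/-- OFF THE VERTEX the image ideal misses some variable. [folklore] -/
theorem not_span_X_le_map_of_not_vertex_le {ρ : extReesAlgebra (weightedMonomialIdeal u w) →+*
      MvPolynomial (Fin d) (S ⧸ Ideal.span (Set.range u))}
    (hρ : Function.Surjective ρ) (hker : RingHom.ker ρ = Ideal.span {extReesAlgebra.tInv (weightedMonomialIdeal u w)})
    (hX : ∀ i, ρ (uT u w i) = MvPolynomial.X i)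
    (𝔫 : Ideal (extReesAlgebra (weightedMonomialIdeal u w))) (hT : extReesAlgebra.tInv (weightedMonomialIdeal u w) ∈ 𝔫)
    (hV : ¬ extReesAlgebra.vertexIdeal (weightedMonomialIdeal u w) ≤ 𝔫) :
    ¬ Ideal.span (Set.range (MvPolynomial.X : Fin d → MvPolynomial (Fin d) (S ⧸ Ideal.span (Set.range u)))) ≤
      𝔫.map ρ := by
  intro hle
  obtain ⟨i, hi⟩ := exists_uT_not_mem u w hV
  apply hi
  rw [← comap_map_eq_of_ker_eq ρ hρ hker 𝔫 hT, Ideal.mem_comap, hX]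
  exact hle (Ideal.subset_span ⟨i, rfl⟩)

end LocalGameEFTPointMove

end Summit.ResolutionOfSingularities.ResolutionOfSingularities.Theorems

end
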